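import Mathlib
import HarnessLib

/-!
# The Lindemann–Weierstrass measure (Ably 1994, §II) — arithmetic of the final parameters

`Literature/NumberTheory/Transcendental/LWMeasureMainPropArith.lean` — proofs only (no
definitions, no named facts, nothing asserted), Mathlib-only. The real and natural-number
bookkeeping behind the choice of parameters in the "Proposition principale" of M. Ably, *Une
version quantitative du théorème de Lindemann–Weierstrass*, Acta Arith. 67 (1994) 29–45, §II
pp. 40–41, in the `(M, R)`-parametrisation of `LWMeasureMainProp.lean`:

* `exists_L` — the least `L` with `R ≤ (5/4) L log L` has `L ≥ 3` and `L log L ≤ 4R`;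
* `params_of_R` — `exp(10 Mⁿ log M) ≤ R` then forces `Mⁿ L log M ≤ R`, `Mⁿ ≤ L`, `M² ≤ L`;
* `thresholds` — and `R ≥ 2`, `R ≥ M`, `K + kM ≤ R` for the fixed constants of the construction;
* `T'_bounds`, `siegel_condition` — `T' = ⌊8L/Mⁿ⌋` and Siegel's condition (C₁) (Lemme 1, p. 35)
  for `D = 2^{n+4} d` frequencies and the exponent box `b = DM`;
* `zero_estimate_conditions` — `T = ⌊2^{n+1} c_z L D/Mⁿ⌋ + 1`, `B = ⌊(M−1)/2⌋`, `T_z = ⌊(T−1)/2⌋`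
  satisfy (C₃), (C₄) of Lemme 3 (p. 39) and `s Mⁿ ≤ (2^{n+1} c_z D + 1) L` for `s < T`.

## References

* [Ably1994] M. Ably, *Une version quantitative du théorème de Lindemann–Weierstrass*, Acta Arith.
  67 (1994) 29–45, §II Lemme 1 (C₁) p. 35, Lemme 3 (C₃), (C₄) p. 39, choix des paramètres p. 40.
-/

noncomputable section

open Finset

namespace Literature.NumberTheory.Transcendental

namespace LWMeasure

/-! ### Real-arithmetic preliminaries -/

/-- `1 ≤ log M` for `M ≥ 3`. [folklore] -/
theorem one_le_log_of_three_le {M : ℕ} (hM : 3 ≤ M) : 1 ≤ Real.log (M : ℝ) := by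
  have h3 : (3 : ℝ) ≤ M := by exact_mod_cast hM
  rw [Real.le_log_iff_exp_le (by linarith)]
  exact (Real.exp_one_lt_d9.le.trans (by norm_num)).trans h3

/-- The choice of `L`: for `R ≥ 2` there is an integer `L ≥ 3` with
`(5/4)(L−1) log(L−1) < R ≤ (5/4) L log L`, whence `L log L ≤ 4R`. [folklore] -/
theorem exists_L {R : ℝ} (hR : 2 ≤ R) :
    ∃ L : ℕ, 3 ≤ L ∧ R ≤ 5 / 4 * L * Real.log L ∧ (L : ℝ) * Real.log L ≤ 4 * R := by
  classical
  have hex : ∃ L : ℕ, R ≤ 5 / 4 * L * Real.log L := by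
    refine ⟨⌈R⌉₊ + 3, ?_⟩
    have h3 : 3 ≤ ⌈R⌉₊ + 3 := by omega
    have hlog := one_le_log_of_three_le h3
    have hRL : R ≤ ((⌈R⌉₊ + 3 : ℕ) : ℝ) := by
      have := Nat.le_ceil R
      push_cast
      linarith
    have hL0 : (0 : ℝ) ≤ ((⌈R⌉₊ + 3 : ℕ) : ℝ) := Nat.cast_nonneg _
    nlinarith
  set L := Nat.find hex with hLdef
  have hL : R ≤ 5 / 4 * L * Real.log L := Nat.find_spec hex
  have h3 : 3 ≤ L := by
    by_contra hlt
    push Not at hlt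
    have hlog2 := Real.log_two_lt_d9
    interval_cases L
    · simp at hL; linarith
    · simp at hL; linarith
    · have : (5 : ℝ) / 4 * ((2 : ℕ) : ℝ) * Real.log ((2 : ℕ) : ℝ) < 2 := by
        push_cast; nlinarith
      linarith
  refine ⟨L, h3, hL, ?_⟩
  -- minimality at `L - 1`
  have hmin : ¬ (R ≤ 5 / 4 * ((L - 1 : ℕ) : ℝ) * Real.log ((L - 1 : ℕ) : ℝ)) :=
    Nat.find_min hex (by omega)
  push Not at hmin
  have hL1 : ((L - 1 : ℕ) : ℝ) = (L : ℝ) - 1 := by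
    rw [Nat.cast_sub (by omega)]; simp
  rw [hL1] at hmin
  have hLR : (3 : ℝ) ≤ L := by exact_mod_cast h3
  -- `L log L ≤ 4 (L-1) log (L-1)`
  have hlogpos : 0 ≤ Real.log ((L : ℝ) - 1) := Real.log_nonneg (by linarith)
  have hlogle : Real.log (L : ℝ) ≤ 2 * Real.log ((L : ℝ) - 1) := by
    rw [← Real.log_rpow (by linarith), Real.rpow_two]
    exact Real.log_le_log (by linarith) (by nlinarith)
  have hLle : (L : ℝ) ≤ 2 * ((L : ℝ) - 1) := by linarith
  have hlogL : 0 ≤ Real.log (L : ℝ) := Real.log_nonneg (by linarith)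
  calc (L : ℝ) * Real.log L ≤ (2 * ((L : ℝ) - 1)) * (2 * Real.log ((L : ℝ) - 1)) :=
        mul_le_mul hLle hlogle hlogL (by linarith)
    _ = 4 * (((L : ℝ) - 1) * Real.log ((L : ℝ) - 1)) := by ring
    _ ≤ 4 * R := by nlinarith

/-- Consequences of `exp(10 Mⁿ log M) ≤ R ≤ (5/4) L log L`, `L log L ≤ 4R` (`M, L ≥ 3`, `n ≥ 1`):
`Mⁿ L log M ≤ R`, `Mⁿ ≤ L`, `M² ≤ L`. [folklore] -/
theorem params_of_R {n M L : ℕ} {R : ℝ} (hM : 3 ≤ M) (hL : 3 ≤ L)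
    (hR : Real.exp (10 * (M : ℝ) ^ n * Real.log M) ≤ R) (h1 : R ≤ 5 / 4 * L * Real.log L)
    (h2 : (L : ℝ) * Real.log L ≤ 4 * R) :
    (M : ℝ) ^ n * L * Real.log M ≤ R ∧ M ^ n ≤ L ∧ (M : ℝ) * M ≤ L := by
  have hlogM := one_le_log_of_three_le hM
  have hMR : (3 : ℝ) ≤ M := by exact_mod_cast hM
  have hLR : (3 : ℝ) ≤ L := by exact_mod_cast hL
  have hMn1 : (1 : ℝ) ≤ (M : ℝ) ^ n := one_le_pow₀ (by linarith)
  set X : ℝ := (M : ℝ) ^ n * Real.log M with hX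
  have hX1 : 1 ≤ X := by rw [hX]; nlinarith
  have hRpos : 0 < R := lt_of_lt_of_le (Real.exp_pos _) hR
  -- `log R ≥ 10 X`
  have hlogR : 10 * X ≤ Real.log R := by
    rw [Real.le_log_iff_exp_le hRpos]
    simpa [hX, mul_assoc] using hR
  -- `log R ≤ 1 + 2 log L` from `R ≤ (5/4) L²`
  have hlogL0 : 0 < Real.log (L : ℝ) := Real.log_pos (by linarith)
  have hlogLle : Real.log (L : ℝ) ≤ L := (Real.log_le_sub_one_of_pos (by linarith)).trans (by linarith)
  have hRle : R ≤ 5 / 4 * ((L : ℝ) * L) := by nlinarith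
  have hlogR' : Real.log R ≤ 1 + 2 * Real.log L := by
    have h54 : Real.log (5 / 4 : ℝ) ≤ 1 := by
      have := Real.log_le_sub_one_of_pos (by norm_num : (0 : ℝ) < 5 / 4); linarith
    calc Real.log R ≤ Real.log (5 / 4 * ((L : ℝ) * L)) := Real.log_le_log hRpos hRle
      _ = Real.log (5 / 4) + (Real.log L + Real.log L) := by
          rw [Real.log_mul (by norm_num) (by positivity), Real.log_mul (by positivity) (by positivity)]
      _ ≤ 1 + 2 * Real.log L := by linarith
  have hlogL : 4 * X ≤ Real.log L := by linarith
  -- `L ≥ exp(4X)`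
  have hLexp : Real.exp (4 * X) ≤ L := by
    calc Real.exp (4 * X) ≤ Real.exp (Real.log L) := Real.exp_le_exp.2 hlogL
      _ = L := Real.exp_log (by linarith)
  refine ⟨?_, ?_, ?_⟩
  · -- `Mⁿ L log M = L X ≤ L log L / 4 ≤ R`
    have : (L : ℝ) * X ≤ (L : ℝ) * Real.log L / 4 := by nlinarith
    calc (M : ℝ) ^ n * L * Real.log M = L * X := by rw [hX]; ring
      _ ≤ R := by linarith
  · -- `Mⁿ ≤ exp(n log M) ≤ exp(4X) ≤ L`
    have hnM : (n : ℝ) ≤ (M : ℝ) ^ n := by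
      have := (Nat.lt_pow_self (show 1 < M by omega) (n := n)).le
      exact_mod_cast this
    have h4 : (n : ℝ) * Real.log M ≤ 4 * X := by rw [hX]; nlinarith
    have : ((M ^ n : ℕ) : ℝ) ≤ L := by
      calc ((M ^ n : ℕ) : ℝ) = Real.exp ((n : ℝ) * Real.log M) := by
            rw [Real.exp_nat_mul, Real.exp_log (by linarith)]; push_cast; ring
        _ ≤ Real.exp (4 * X) := Real.exp_le_exp.2 h4
        _ ≤ L := hLexp
    exact_mod_cast this
  · -- `M² = exp(2 log M) ≤ exp(4X) ≤ L`
    have h2 : 2 * Real.log M ≤ 4 * X := by rw [hX]; nlinarith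
    calc (M : ℝ) * M = Real.exp (2 * Real.log M) := by
          rw [show (2 : ℝ) * Real.log M = ((2 : ℕ) : ℝ) * Real.log M by norm_num, Real.exp_nat_mul,
            Real.exp_log (by linarith)]; ring
      _ ≤ Real.exp (4 * X) := Real.exp_le_exp.2 h2
      _ ≤ L := hLexp

/-- The threshold facts: for `M ≥ 3`, `M ≥ K`, `M ≥ 4(1 + k)` and `exp(10 Mⁿ log M) ≤ R`:
`R ≥ 2`, `R ≥ M` and `K + k M ≤ R`. [folklore] -/
theorem thresholds {n M : ℕ} {R K k : ℝ} (hn : 1 ≤ n) (hM : 3 ≤ M) (hKM : K ≤ M)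
    (hk : 0 ≤ k) (hkM : 4 * (1 + k) ≤ M) (hR : Real.exp (10 * (M : ℝ) ^ n * Real.log M) ≤ R) :
    2 ≤ R ∧ (M : ℝ) ≤ R ∧ K + k * M ≤ R := by
  have hlogM := one_le_log_of_three_le hM
  have hMR : (3 : ℝ) ≤ M := by exact_mod_cast hM
  have hMn : (M : ℝ) ≤ (M : ℝ) ^ n := by
    calc (M : ℝ) = (M : ℝ) ^ 1 := (pow_one _).symm
      _ ≤ (M : ℝ) ^ n := pow_le_pow_right₀ (by linarith) hn
  -- `R ≥ exp M ≥ (1 + M/2)² ≥ M²/4 + M + 1`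
  have hexpM : Real.exp M ≤ R := by
    refine le_trans (Real.exp_le_exp.2 ?_) hR
    nlinarith
  have hsq : (1 + (M : ℝ) / 2) ^ 2 ≤ Real.exp M := by
    have h := Real.add_one_le_exp ((M : ℝ) / 2)
    have h0 : 0 ≤ (M : ℝ) / 2 + 1 := by positivity
    calc (1 + (M : ℝ) / 2) ^ 2 = ((M : ℝ) / 2 + 1) ^ 2 := by ring
      _ ≤ Real.exp ((M : ℝ) / 2) ^ 2 := pow_le_pow_left₀ h0 h 2
      _ = Real.exp M := by rw [← Real.exp_nat_mul]; ring_nf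
  have hR' : (M : ℝ) ^ 2 / 4 + M + 1 ≤ R := by nlinarith
  refine ⟨by nlinarith, by nlinarith, ?_⟩
  -- `K + k M ≤ (1 + k) M ≤ M²/4 ≤ R`
  have h1 : K + k * M ≤ (1 + k) * M := by nlinarith
  have h2 : (1 + k) * M ≤ (M : ℝ) ^ 2 / 4 := by nlinarith
  nlinarith

/-! ### Natural-number bookkeeping of the parameters -/

/-- `T' = ⌊8L/Mⁿ⌋` satisfies `T' Mⁿ ≤ 8L` and `7L ≤ T' Mⁿ` (`0 < Mⁿ ≤ L`), hence `T' ≥ 1`.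
[cite: Ably1994, §II choix des paramètres p. 40 (T')] -/
theorem T'_bounds {L P : ℕ} (hP : 0 < P) (hPL : P ≤ L) :
    8 * L / P * P ≤ 8 * L ∧ 7 * L ≤ 8 * L / P * P ∧ 1 ≤ 8 * L / P := by
  have h3 : P * (8 * L / P) + 8 * L % P = 8 * L := Nat.div_add_mod _ _
  have h2 : 8 * L % P < P := Nat.mod_lt _ hP
  generalize hq : 8 * L / P = q at h3 ⊢
  have hcomm : q * P = P * q := Nat.mul_comm _ _
  generalize hpq : P * q = pq at h3 hcomm
  rw [hcomm]
  refine ⟨by omega, by omega, ?_⟩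
  by_contra h0
  push Not at h0
  have hq0 : q = 0 := Nat.lt_one_iff.mp h0
  subst hq0
  omega

/-- Siegel's condition (C₁) for `D = 2^{n+4} d`, `b = DM`, `T' Mⁿ ≤ 8L`:
`2 Mⁿ T' d (b + DM)ⁿ ≤ L D bⁿ`. [cite: Ably1994, §II Lemme 1 (C₁) p. 35] -/
theorem siegel_condition {n d L M T' : ℕ} (hT' : T' * M ^ n ≤ 8 * L) :
    2 * (M ^ n * (T' * (d * (2 ^ (n + 4) * d * M + 2 ^ (n + 4) * d * M) ^ n))) ≤
      L * (2 ^ (n + 4) * d) * (2 ^ (n + 4) * d * M) ^ n := by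
  set b : ℕ := 2 ^ (n + 4) * d * M with hb
  have h2b : (b + b) ^ n = 2 ^ n * b ^ n := by rw [← two_mul, mul_pow]
  rw [h2b]
  have key : 2 * (M ^ n * (T' * (d * (2 ^ n * b ^ n)))) = (2 ^ (n + 1) * d) * (T' * M ^ n) * b ^ n := by
    ring
  rw [key]
  calc 2 ^ (n + 1) * d * (T' * M ^ n) * b ^ n ≤ 2 ^ (n + 1) * d * (8 * L) * b ^ n := by
        gcongr
    _ = L * (2 ^ (n + 4) * d) * b ^ n := by ring

/-- The zero-estimate conditions (C₃), (C₄) and the range of `s` for `T = ⌊2^{n+1} c_z L D/Mⁿ⌋ + 1`,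
`B = ⌊(M−1)/2⌋`, `T_z = ⌊(T−1)/2⌋` (`M ≥ 3`, `M ≤ L`, `Mⁿ ≤ L`, `D ≥ 2`).
[cite: Ably1994, §II Lemme 3 (C₃), (C₄) p. 39 and p. 40] -/
theorem zero_estimate_conditions {n cz L D M : ℕ} (hn : 1 ≤ n) (hM : 3 ≤ M) (hML : M ≤ L)
    (hMn : M ^ n ≤ L) :
    1 ≤ (M - 1) / 2 ∧ 2 * ((M - 1) / 2) < M ∧
      2 * ((2 ^ (n + 1) * cz * L * D / M ^ n + 1 - 1) / 2) + 1 ≤ 2 ^ (n + 1) * cz * L * D / M ^ n + 1 ∧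
      cz * (L - 1) * (D - 1) <
        ((2 ^ (n + 1) * cz * L * D / M ^ n + 1 - 1) / 2 + 1) * ((M - 1) / 2 + 1) ^ n ∧
      cz * (D - 1) < ((2 ^ (n + 1) * cz * L * D / M ^ n + 1 - 1) / 2 + 1) * ((M - 1) / 2 + 1) ^ (n - 1) ∧
      ∀ s, s < 2 ^ (n + 1) * cz * L * D / M ^ n + 1 → s * M ^ n ≤ (2 ^ (n + 1) * cz * D + 1) * L := by
  set P : ℕ := M ^ n with hP
  set a : ℕ := 2 ^ (n + 1) * cz * L * D with ha
  have hPpos : 0 < P := by rw [hP]; positivity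
  have hdm : P * (a / P) + a % P = a := Nat.div_add_mod a P
  have hmod : a % P < P := Nat.mod_lt _ hPpos
  have hdiv : a / P * P ≤ a := Nat.div_mul_le_self _ _
  generalize hq : a / P = q at hdm hdiv ⊢
  set B : ℕ := (M - 1) / 2 with hB
  simp only [Nat.add_sub_cancel]
  set Tz : ℕ := q / 2 with hTz
  have hB1 : 1 ≤ B := by rw [hB]; omega
  have hB2 : 2 * B < M := by rw [hB]; omega
  have hTz1 : 2 * Tz + 1 ≤ q + 1 := by rw [hTz]; omega
  -- `2(B+1) ≥ M`, `2(Tz+1) ≥ q + 1`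
  have hBM : M ≤ 2 * (B + 1) := by rw [hB]; omega
  have hTT : q + 1 ≤ 2 * (Tz + 1) := by rw [hTz]; omega
  -- `(q+1) P ≥ a + 1`
  have hTP : a + 1 ≤ (q + 1) * P := by
    have h5 : (q + 1) * P = P * q + P := by ring
    rw [h5]
    generalize P * q = pq at hdm ⊢
    omega
  -- `2^{n+1} (Tz+1)(B+1)ⁿ ≥ (q+1) Mⁿ`
  have hpowB : P ≤ 2 ^ n * (B + 1) ^ n := by
    rw [hP, ← mul_pow]; exact Nat.pow_le_pow_left hBM n
  have hmain : (q + 1) * P ≤ 2 ^ (n + 1) * ((Tz + 1) * (B + 1) ^ n) := by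
    calc (q + 1) * P ≤ (2 * (Tz + 1)) * (2 ^ n * (B + 1) ^ n) := Nat.mul_le_mul hTT hpowB
      _ = 2 ^ (n + 1) * ((Tz + 1) * (B + 1) ^ n) := by ring
  refine ⟨hB1, hB2, hTz1, ?_, ?_, ?_⟩
  · -- (C₃)
    have h1 : 2 ^ (n + 1) * (cz * (L - 1) * (D - 1)) ≤ a := by
      rw [ha]
      have hL1 : L - 1 ≤ L := Nat.sub_le _ _
      have hD1 : D - 1 ≤ D := Nat.sub_le _ _
      calc 2 ^ (n + 1) * (cz * (L - 1) * (D - 1)) = 2 ^ (n + 1) * cz * (L - 1) * (D - 1) := by ring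
        _ ≤ 2 ^ (n + 1) * cz * L * D := by gcongr
    have h2 : 2 ^ (n + 1) * (cz * (L - 1) * (D - 1)) < 2 ^ (n + 1) * ((Tz + 1) * (B + 1) ^ n) := by
      omega
    exact Nat.lt_of_mul_lt_mul_left h2
  · -- (C₄)
    obtain ⟨n', rfl⟩ : ∃ n', n = n' + 1 := ⟨n - 1, by omega⟩
    simp only [Nat.add_sub_cancel]
    have hpowB' : M ^ n' ≤ 2 ^ n' * (B + 1) ^ n' := by
      rw [← mul_pow]; exact Nat.pow_le_pow_left hBM n'
    have hmain' : (q + 1) * M ^ n' ≤ 2 ^ (n' + 1) * ((Tz + 1) * (B + 1) ^ n') := by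
      calc (q + 1) * M ^ n' ≤ (2 * (Tz + 1)) * (2 ^ n' * (B + 1) ^ n') := Nat.mul_le_mul hTT hpowB'
        _ = 2 ^ (n' + 1) * ((Tz + 1) * (B + 1) ^ n') := by ring
    have hPM : P = M ^ n' * M := by rw [hP, pow_succ]
    have h1 : 2 ^ (n' + 1) * (cz * (D - 1)) * M < (q + 1) * M ^ n' * M := by
      have hD1 : D - 1 ≤ D := Nat.sub_le _ _
      have hle : 2 ^ (n' + 1) * (cz * (D - 1)) * M ≤ a := by
        rw [ha]
        calc 2 ^ (n' + 1) * (cz * (D - 1)) * M ≤ 2 ^ (n' + 1) * (cz * D) * L := by gcongr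
          _ ≤ 2 ^ (n' + 1) * (cz * D) * L + 2 ^ (n' + 1) * (cz * D) * L := Nat.le_add_right _ _
          _ = 2 ^ (n' + 1 + 1) * cz * L * D := by ring
      calc 2 ^ (n' + 1) * (cz * (D - 1)) * M ≤ a := hle
        _ < (q + 1) * P := by omega
        _ = (q + 1) * M ^ n' * M := by rw [hPM]; ring
    have h2 : 2 ^ (n' + 1) * (cz * (D - 1)) < (q + 1) * M ^ n' := Nat.lt_of_mul_lt_mul_right h1
    have h3 : 2 ^ (n' + 1) * (cz * (D - 1)) < 2 ^ (n' + 1) * ((Tz + 1) * (B + 1) ^ n') :=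
      lt_of_lt_of_le h2 hmain'
    exact Nat.lt_of_mul_lt_mul_left h3
  · -- the range of `s`
    intro s hs
    have hs' : s ≤ q := by omega
    calc s * M ^ n ≤ q * P := by rw [← hP]; exact Nat.mul_le_mul_right _ hs'
      _ ≤ a := hdiv
      _ = (2 ^ (n + 1) * cz * D) * L := by rw [ha]; ring
      _ ≤ (2 ^ (n + 1) * cz * D + 1) * L := Nat.mul_le_mul_right _ (Nat.le_succ _)

/-! ### The Proposition principale -/

/-- An exponent vector with entries `< N + 1` as a `Finsupp`. [folklore] -/
theorem equivFunOnFinite_symm_apply_val {m N : ℕ} (v : Fin m → Fin (N + 1)) (i : Fin m) :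
    (Finsupp.equivFunOnFinite.symm (fun i => ((v i : ℕ))) : Fin m →₀ ℕ) i = v i := by
  simp

end LWMeasure

end Literature.NumberTheory.Transcendental

end
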